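import Summits.CriticalPhenomena.PercolationContinuityZ3.Theorems.PercNearOneGluingNoHeavyLowerTailSahiTangentLayerLaw
import Summits.CriticalPhenomena.PercolationContinuityZ3.Theorems.PercNearOneGluingNoHeavyLowerTailSahiTangentScaling
import HarnessLib

/-!
# `NoHeavyLowerTail` (crux stmt-CriticalPhenomena-4575), Sahi programme: **OR-ING ONE FRESH COIN ONTO EVERY MEMBER — the exact law at every order:
# `E_{n+1}^{B_p⊗μ}(f_0 ∨ ε, …, f_n ∨ ε) = φ_{n+1}(p) + E_{n+1}^{(1−p)·μ}(f) − Σ_{∅≠S⊊[n+1]} φ_{|S|}(p)·E_{|Sᶜ|}^{(1−p)·μ}(f|_{Sᶜ})`**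
# (`φ_k(p) = p(1−p)(2−p)⋯(k−1−p)` = gen 51's `scalingCoeff`; `μ` a probability weight; any real `p`, any functions `f`)

Support file (Sahi cell, seat `prim-sahi-p1`, generation 52; `--supports stmt-CriticalPhenomena-4575`).  Pure proofs, NO definitions, no `sorry`, standard
axioms.  The "push-up by a fresh coin on all members" of the hitting-event lane (prim-l12-p5, memo FROM-prim-l12-p5-g14-PUSHUP-LEMMA §3: "T ⊇ S in moments:
`E_S(π') = Σ_{R⊆S} r(|S∖R|)·E_R(f·c̄) + p(1−p)⋯(|S|−1−p)`, `r(0)=1`, `r(k) = −p(1−p)⋯(k−1−p)`"; order 3 in Lean: `…SahiFreshCoinOrderThree`), here AT EVERY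
ORDER as a corollary of the `(E¹,E⁰)` law of total `E_n` (`sahiE_coin_pair_eq_layers`, gen 52): the top sections of `f_l ∨ ε` are the constant `1`, and
`E_k^{p·μ}(1,…,1) = φ_k(p)` (`sahiE_smul_const_one`, unnormalised branching).  Reading: `E^{(1−p)·μ}_k(f|_R) = E_k((f·c̄)|_R)` are the functionals of the
family AND-ed with the complementary coin, all `≥ 0` when `f` is hereditarily Sahi-nonnegative (`sahiE_smul_weight_eq_sum`, gen 51), and they enter with
the NEGATIVE coefficients `−φ_{n+1−|R|}(p)`: positivity of the all-member push-up is the statement that the top scaled functional plus `φ_{n+1}(p)` dominates the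
`φ`-weighted proper sub-functionals — true at order 3 for every law [prim-l12-p5 g14/g15], abstractly certified at order 4 [ttrl cp-mix], open in general;
nothing about it is asserted here. [this work; cf. prim-l12-p5 g14 §3]
-/

namespace Summit.CriticalPhenomena.PercolationContinuityZ3.Theorems.SahiTangent

open Finset Function Literature.Combinatorics.Sahi2008
open scoped BigOperators

noncomputable section

variable {α : Type*} [Fintype α]

/-- `E_{k+1}^{s·μ}(1,…,1) = φ_{k+1}(s)` for a probability weight `μ` (unnormalised branching: `E_{k+2}(1; 1^{k+1}) = (k+1−s)·E_{k+1}(1^{k+1})`,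
`E_1^{s·μ}(1) = s`). [this work] -/
theorem sahiE_smul_const_one {μ : α → ℝ} (hμ : ∑ x, μ x = 1) (s : ℝ) :
    ∀ k : ℕ, sahiE (s • μ) (k + 1) (fun (_ : Fin (k + 1)) (_ : α) => (1 : ℝ)) = scalingCoeff s (k + 1)
  | 0 => by
    rw [sahiE_one_apply, scalingCoeff_one, ex]
    simp only [Pi.smul_apply, smul_eq_mul, mul_one, ← Finset.mul_sum, hμ]
  | k + 1 => by
    rw [sahiE_succ_succ, scalingCoeff_succ]
    have htail : Fin.tail (fun (_ : Fin (k + 2)) (_ : α) => (1 : ℝ)) = fun (_ : Fin (k + 1)) (_ : α) => (1 : ℝ) := rfl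
    have hupd : ∀ i : Fin (k + 1), update (fun (_ : Fin (k + 1)) (_ : α) => (1 : ℝ)) i
        ((fun (_ : Fin (k + 1)) (_ : α) => (1 : ℝ)) i * fun _ => 1) = fun (_ : Fin (k + 1)) (_ : α) => (1 : ℝ) := by
      intro i; funext j x
      by_cases hj : j = i
      · subst hj; simp
      · rw [update_of_ne hj]
    have hex : ex (s • μ) ((fun (_ : Fin (k + 2)) (_ : α) => (1 : ℝ)) 0) = s := by
      simp only [ex, Pi.smul_apply, smul_eq_mul, mul_one, ← Finset.mul_sum, hμ]
    rw [htail]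
    simp only [hupd, sahiE_smul_const_one hμ s k, Finset.sum_const, Finset.card_univ, Fintype.card_fin, nsmul_eq_mul, hex]
    push_cast
    ring

/-- Version with a positivity hypothesis on the order (for dependent rewriting under sums). [this work] -/
theorem sahiE_smul_const_one' {μ : α → ℝ} (hμ : ∑ x, μ x = 1) (s : ℝ) {m : ℕ} (hm : 0 < m) :
    sahiE (s • μ) m (fun (_ : Fin m) (_ : α) => (1 : ℝ)) = scalingCoeff s m := by
  obtain ⟨k, rfl⟩ := Nat.exists_eq_add_one.2 hm
  exact sahiE_smul_const_one hμ s k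

/-- **OR-ING ONE FRESH COIN ONTO EVERY MEMBER, every order.**  For a probability weight `μ` on `α`, any real `p` and any family `f` of `n+1`
functions, the family `F_l(ε, x) = ε ? 1 : f_l(x)` on `Bool × α` (for indicators: `f_l ∨ ε`) satisfies under the coin product `B_p ⊗ μ`
`E_{n+1}(F) = φ_{n+1}(p) + E_{n+1}^{(1−p)·μ}(f) − Σ_{∅≠S⊊[n+1]} φ_{|S|}(p) · E_{|Sᶜ|}^{(1−p)·μ}(f|_{Sᶜ})`.
[this work; cf. prim-l12-p5 g14 §3 (moment form), …SahiFreshCoinOrderThree (order 3)] -/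
theorem sahiE_coin_orAll_eq {μ : α → ℝ} (hμ : ∑ x, μ x = 1) (p : ℝ) {n : ℕ} (f : Fin (n + 1) → α → ℝ) :
    sahiE (fun z : Bool × α => if z.1 then p * μ z.2 else (1 - p) * μ z.2) (n + 1)
        (fun l (z : Bool × α) => if z.1 then 1 else f l z.2)
      = scalingCoeff p (n + 1) + sahiE ((1 - p) • μ) (n + 1) f
        - ∑ S : Finset (Fin (n + 1)) with (S.Nonempty ∧ S ≠ univ),
            scalingCoeff p S.card * sahiE ((1 - p) • μ) Sᶜ.card (fun j => f (Sᶜ.orderEmbOfFin rfl j)) := by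
  classical
  have h := sahiE_coin_pair_eq_layers μ p (fun (_ : Fin (n + 1)) (_ : α) => (1 : ℝ)) f
  rw [sahiE_smul_const_one hμ p n] at h
  rw [h]
  congr 1
  refine Finset.sum_congr rfl fun S hS => ?_
  have hS' := (Finset.mem_filter.1 hS).2
  rw [sahiE_smul_const_one' hμ p hS'.1.card_pos]

/-- **OR-ing one fresh coin onto the members in `T` only** (the general push-up of the hitting lane): with `g¹_l = 1` for `l ∈ T` and
`g¹_l = f_l` otherwise,
`E_n^{B_p⊗μ}(F^T) = E_n^{p·μ}(g¹) + E_n^{(1−p)·μ}(f) − Σ_{∅≠S⊊[n]} E^{p·μ}_{|S|}(g¹|_S)·E^{(1−p)·μ}_{|Sᶜ|}(f|_{Sᶜ})` — the `(E¹,E⁰)` law with constant-`1`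
top sections on `T` (any real weight `μ`, any real `p`; the constant slots of `g¹|_S` peel off by unnormalised branching,
`SahiMomentExpansion.sahiE_one_cons_eq`). [this work; cf. prim-l12-p5 g14 §3 (disjoint-support form)] -/
theorem sahiE_coin_orOn_eq (μ : α → ℝ) (p : ℝ) {n : ℕ} (T : Finset (Fin n)) (f : Fin n → α → ℝ) :
    sahiE (fun z : Bool × α => if z.1 then p * μ z.2 else (1 - p) * μ z.2) n
        (fun l (z : Bool × α) => if z.1 then (if l ∈ T then 1 else f l z.2) else f l z.2)
      = sahiE (p • μ) n (fun l x => if l ∈ T then 1 else f l x) + sahiE ((1 - p) • μ) n f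
        - ∑ S : Finset (Fin n) with (S.Nonempty ∧ S ≠ univ),
            sahiE (p • μ) S.card (fun j x => if S.orderEmbOfFin rfl j ∈ T then 1 else f (S.orderEmbOfFin rfl j) x)
              * sahiE ((1 - p) • μ) Sᶜ.card (fun j => f (Sᶜ.orderEmbOfFin rfl j)) :=
  sahiE_coin_pair_eq_layers μ p (fun l x => if l ∈ T then (1 : ℝ) else f l x) f

end

end Summit.CriticalPhenomena.PercolationContinuityZ3.Theorems.SahiTangent
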